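import Mathlib

/-!
# T5GramScaling — scaling a Gram matrix: hermitian ↔ skew-hermitian, the unitary group, and the
determinant class in odd and even rank

Two one-line [A]s of the record, made kernel on an arbitrary field `E` with a ring involution
`star` (the local field `E_v` or the global CM field in the route):

* row N2.2.2 of route/T5-N2-route-3.md (l. 17): «hermitian ↔ skew-hermitian by scaling with
  `δ ∈ E^{×,−}` (same groups)» — `isSkewHermitian_smul` (a trace-zero scalar times a hermitian
  Gram matrix is skew-hermitian), `unitaryOfMat_smul` (a non-zero scalar does not change the
  unitary group `{g | gᴴ H g = H}`; the `n × n` form of file 82's `unitaryOf_smul`);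
* (B1.c) of route/T4-B1-p3.md v7 («at every finite `v`, `U(V_v)` is isomorphic to the unitary
  group of the other local isomorphism class of rank 3 as well (`n` odd)»): the determinant of
  `c • H` is `c^n · det H`; for `n = 2k + 1` this is `c · N(c^k) · det H` with `N(x) = x · star x`
  (`det_smul_odd`), so the determinant CLASS modulo norms moves by `c` — with `c` a non-norm the
  scaled matrix represents the other class and `unitaryOfMat_smul` gives the same group; for
  `n = 2k` it is `N(c^k) · det H` (`det_smul_even`) — scaling by a star-fixed scalar does not move
  the class. For a trace-zero `δ` in rank two, `det (δ • H) = -N(δ) · det H` (`det_smul_anti_two`,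
  the determinant identity of row N2.2.9, `δ² = −N(δ)`).

No new definition beyond the set `unitaryOfMat H` (the unitary group as a set of matrices).
-/

namespace Summit.Ventures.HodgeRepro2.T5GramScaling

variable {E : Type*} [Field E] [StarRing E] {n : Type*}

/-- A star-fixed scalar times a hermitian Gram matrix is hermitian. -/
theorem isHermitian_smul_of_star_eq {H : Matrix n n E} (hH : H.IsHermitian) {c : E}
    (hc : star c = c) : (c • H).IsHermitian :=
  hH.smul hc

/-- A trace-zero scalar (`star δ = -δ`) times a hermitian Gram matrix is skew-hermitian:
row N2.2.2's «hermitian ↔ skew-hermitian by scaling with `δ ∈ E^{×,−}`». -/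
theorem isSkewHermitian_smul {H : Matrix n n E} (hH : H.IsHermitian) {δ : E}
    (hδ : star δ = -δ) : (δ • H).conjTranspose = -(δ • H) := by
  rw [Matrix.conjTranspose_smul, hδ, hH.eq, neg_smul]

/-- A square of a star-fixed scalar is a norm: `x ^ 2 = x · star x`. -/
theorem sq_eq_mul_star_of_star_eq {x : E} (hx : star x = x) : x ^ 2 = x * star x := by
  rw [hx, sq]

/-- A trace-zero scalar squares to minus its norm: `δ ^ 2 = -(δ · star δ)` (row N2.2.9's
`δ² = −N(δ)`). -/
theorem sq_eq_neg_mul_star_of_star_eq_neg {δ : E} (hδ : star δ = -δ) :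
    δ ^ 2 = -(δ * star δ) := by
  rw [hδ, mul_neg, neg_neg, sq]

variable [Fintype n]

/-- The unitary group of a Gram matrix `H`, as a set of `n × n` matrices: `{g | gᴴ H g = H}`. -/
def unitaryOfMat (H : Matrix n n E) : Set (Matrix n n E) :=
  {g | g.conjTranspose * H * g = H}

/-- Membership in `unitaryOfMat` unfolded. -/
theorem mem_unitaryOfMat_iff (H g : Matrix n n E) :
    g ∈ unitaryOfMat H ↔ g.conjTranspose * H * g = H :=
  Iff.rfl

/-- A non-zero scalar does not change the unitary group: `U(c • H) = U(H)` — «same groups» of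
row N2.2.2 (the skew-hermitian `δ • H` has the unitary group of the hermitian `H`) and of (B1.c)
(the two rank-3 classes `H`, `c • H` have the same unitary group). -/
theorem unitaryOfMat_smul {c : E} (hc : c ≠ 0) (H : Matrix n n E) :
    unitaryOfMat (c • H) = unitaryOfMat H := by
  ext g
  simp only [unitaryOfMat, Set.mem_setOf_eq, Matrix.mul_smul, Matrix.smul_mul]
  exact (smul_right_injective (Matrix n n E) hc).eq_iff

variable [DecidableEq n]

/-- Odd rank `n = 2k + 1`: `det (c • H) = c · N(c^k) · det H` with `N(y) = y · star y` — the
determinant class modulo norms moves by `c` (so for a non-norm `c` the matrix `c • H` represents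
the other isometry class, with the same unitary group by `unitaryOfMat_smul`). -/
theorem det_smul_odd {c : E} (hc : star c = c) (H : Matrix n n E) {k : ℕ}
    (hn : Fintype.card n = 2 * k + 1) :
    (c • H).det = c * (c ^ k * star (c ^ k)) * H.det := by
  rw [Matrix.det_smul, hn, star_pow, hc]
  ring

/-- Even rank `n = 2k`: `det (c • H) = N(c^k) · det H` — scaling by a star-fixed scalar does not
move the determinant class modulo norms. -/
theorem det_smul_even {c : E} (hc : star c = c) (H : Matrix n n E) {k : ℕ}
    (hn : Fintype.card n = 2 * k) :
    (c • H).det = (c ^ k * star (c ^ k)) * H.det := by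
  rw [Matrix.det_smul, hn, star_pow, hc]
  ring

/-- Rank two, trace-zero scalar: `det (δ • H) = -N(δ) · det H` — the skew-hermitian plane
`δ • H` of row N2.2.2 has determinant `-N(δ)` times the hermitian one (row N2.2.9's identity). -/
theorem det_smul_anti_two {δ : E} (hδ : star δ = -δ) (H : Matrix n n E)
    (hn : Fintype.card n = 2) :
    (δ • H).det = -(δ * star δ) * H.det := by
  rw [Matrix.det_smul, hn, sq_eq_neg_mul_star_of_star_eq_neg hδ]

end Summit.Ventures.HodgeRepro2.T5GramScaling
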